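import Summits.FinalStateConjecture.FinalStateConjecture.Theorems.PhotonSphereChannelsChannelsResolveTameDevelopmentsREnergyTails
import Summits.FinalStateConjecture.FinalStateConjecture.Theorems.PhotonSphereChannelsChannelsResolveTameDevelopmentsRTotalEnergyConservation

/-!
# Crux `WindowedShellChannels` (stmt-FinalStateConjecture-14085), line `Sketch`, stub `stub_lateDropExp` —
# late drop of the lagged far energy under an exponentially small potential tail

Registered stub `stub_lateDropExp` of line `Sketch`, over the Literature vocabulary
`ReggeWheeler.{IsSolution, CauchyDataSupportedOn, farEnergy, farChannelEnergy, totalEnergy, energyDensity}`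
(curried `ψ : ℝ → ℝ → ℝ`, `deriv` of slices).  For `V ≥ 0` differentiable with `V(x) ≤ K e^{−x/2}` (`K ≥ 1`), a
global `C²` solution `ψ` of `ψ_tt − ψ_xx + Vψ = 0` with Cauchy data supported in `[−R, R]` (`R ≥ 1`), a lag
`H ≥ 0` and a time `T ≥ R + 2H + 2`: the far energy beyond the lagged edge `x = T − H` exceeds its limit (the far
channel energy along `atTop`) by at most `8K²(R+H+2)³e^{(H−T)/2}·E`, `E` the total energy.

Proof (sub-namespace `LateDropExp`, Fréchet vocabulary `u : ℝ × ℝ → ℝ` of the `WaveEnergy` files, `S = R + 1`):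
* SUPPORT: `u` and its first partials vanish on `{S + |τ| ≤ y}` (`WaveEnergy.eq_zero_right_of_data`);
* FLUX (`farReal_eq_add_flux`): `WaveEnergy.energy_identity_affine` with the moving left end `−H + t` and the fixed
  right end `S + T₂` (beyond the support) gives, for `0 ≤ T ≤ T₂`,
  `∫_{−H+T}^{S+T₂} e(T,·) = ∫_{−H+T₂}^{S+T₂} e(T₂,·) + ∫_T^{T₂} [w² + Vu²](t, −H + t) dt`, `w = u_t + u_x`;
* TRANSPORT (`hasDerivAt_incoming`, `incoming_abs_le`): `(∂_t − ∂_x) w = −Vu`, so along the incoming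
  characteristic `τ ↦ (τ, c − τ)` the quantity `w` is the integral of `−Vu` from the point where the
  characteristic leaves the support; there `V ≤ K e^{−(t−H)/2}` and `u² ≤ 2(S+H)E` (`sq_le_of_vanish`: fundamental
  theorem of calculus from the right end of the support and Cauchy–Schwarz, `RW.sq_le_of_deriv_tail_left`), whence
  the edge bound `[w² + Vu²](t, t − H) ≤ 4K²(S+H+1)³E e^{(H−t)/2}` (`edge_flux_le`);
* integrate over `[T, T₂]` (`farReal_le`) and pass to the `liminf` in `T₂` (`stub_lateDropExp`).
Standard material [folklore]; no new definitions.
-/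

noncomputable section

set_option linter.dupNamespace false

namespace Summit.FinalStateConjecture.FinalStateConjecture.Theorems.WindowedShellChannelsSketch

open Literature.Geometry.Lorentzian Literature.Geometry.Lorentzian.ReggeWheeler Filter Set MeasureTheory
open scoped ENNReal Topology

namespace LateDropExp

section Frechet

variable {u : ℝ × ℝ → ℝ} {V : ℝ → ℝ} {e w : ℝ × ℝ → ℝ}

/-- **Transport of `w = u_t + u_x` along incoming characteristics.** For a `C²` solution of
`u_tt − u_xx + Vu = 0`, `d/dτ w(τ, c − τ) = −V(c − τ) u(τ, c − τ)` (`(∂_t − ∂_x)(u_t + u_x) = u_tt − u_xx`).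
[folklore] -/
theorem hasDerivAt_incoming (hu : ContDiff ℝ 2 u)
    (hsol : ∀ z : ℝ × ℝ, fderiv ℝ (fderiv ℝ u) z (1, 0) (1, 0)
      - fderiv ℝ (fderiv ℝ u) z (0, 1) (0, 1) + V z.2 * u z = 0)
    (hw : ∀ z, w z = fderiv ℝ u z (1, 0) + fderiv ℝ u z (0, 1)) (c τ : ℝ) :
    HasDerivAt (fun σ => w (σ, c - σ)) (-(V (c - τ) * u (τ, c - τ))) τ := by
  have hγ : HasDerivAt (fun σ : ℝ => ((σ, c - σ) : ℝ × ℝ)) ((1 : ℝ), (-1 : ℝ)) τ :=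
    (hasDerivAt_id τ).prodMk ((hasDerivAt_id τ).const_sub c)
  have h1 := WaveEnergy.hasDerivAt_comp_curve (WaveEnergy.differentiable_fderiv_apply hu (1, 0)) hγ
  have h2 := WaveEnergy.hasDerivAt_comp_curve (WaveEnergy.differentiable_fderiv_apply hu (0, 1)) hγ
  have hfun : (fun σ => w (σ, c - σ))
      = fun σ => fderiv ℝ u (σ, c - σ) (1, 0) + fderiv ℝ u (σ, c - σ) (0, 1) := funext fun σ => hw _
  rw [hfun]
  refine (h1.add h2).congr_deriv ?_
  rw [WaveEnergy.fderiv_fderiv_apply hu, WaveEnergy.fderiv_fderiv_apply hu]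
  have hv : ((1 : ℝ), (-1 : ℝ)) = ((1 : ℝ), (0 : ℝ)) + (-1 : ℝ) • ((0 : ℝ), (1 : ℝ)) := by
    ext <;> simp
  rw [hv, map_add, map_smul]
  simp only [add_apply, FunLike.coe_smul, Pi.smul_apply, smul_eq_mul]
  have hsymm := WaveEnergy.fderiv_fderiv_symm hu (τ, c - τ) (1, 0) (0, 1)
  have hs := hsol (τ, c - τ)
  simp only at hs
  linear_combination hs + hsymm

/-- **Transport bound.** If `w` vanishes at the foot `(τ₀, c − τ₀)` of the incoming characteristic and
`|Vu| ≤ Q` along it up to time `t ≥ τ₀`, then `|w(t, c − t)| ≤ Q (t − τ₀)`. [folklore] -/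
theorem incoming_abs_le (hu : ContDiff ℝ 2 u) (hV : Differentiable ℝ V)
    (hsol : ∀ z : ℝ × ℝ, fderiv ℝ (fderiv ℝ u) z (1, 0) (1, 0)
      - fderiv ℝ (fderiv ℝ u) z (0, 1) (0, 1) + V z.2 * u z = 0)
    (hw : ∀ z, w z = fderiv ℝ u z (1, 0) + fderiv ℝ u z (0, 1)) {c τ₀ t Q : ℝ} (hτ₀ : τ₀ ≤ t)
    (h0 : w (τ₀, c - τ₀) = 0) (hQ : ∀ τ ∈ Icc τ₀ t, |V (c - τ) * u (τ, c - τ)| ≤ Q) :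
    |w (t, c - t)| ≤ Q * (t - τ₀) := by
  have hVc := hV.continuous
  have huc := (WaveEnergy.differentiable_of_contDiff_two hu).continuous
  have hcont : Continuous fun τ => -(V (c - τ) * u (τ, c - τ)) := by fun_prop
  have hftc := intervalIntegral.integral_eq_sub_of_hasDerivAt
    (fun τ _ => hasDerivAt_incoming hu hsol hw c τ) (hcont.intervalIntegrable τ₀ t)
  rw [h0, sub_zero] at hftc
  rw [← hftc]
  have h := intervalIntegral.norm_integral_le_of_norm_le_const (a := τ₀) (b := t) (C := Q)
    (f := fun τ => -(V (c - τ) * u (τ, c - τ))) (fun τ hτ => by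
      rw [uIoc_of_le hτ₀] at hτ
      rw [Real.norm_eq_abs, abs_neg]
      exact hQ τ ⟨hτ.1.le, hτ.2⟩)
  rwa [Real.norm_eq_abs, abs_of_nonneg (sub_nonneg.2 hτ₀)] at h

/-- **Pointwise bound from the kinetic energy.** If `u(τ, a) = 0` and every slice has energy `≤ E₀`,
then `u(τ, y)² ≤ 2(a − y)E₀` for `y ≤ a` (fundamental theorem of calculus and Cauchy–Schwarz,
`RW.sq_le_of_deriv_tail_left`, with `u_x² ≤ e`). [folklore] -/
theorem sq_le_of_vanish (hu : ContDiff ℝ 2 u) (hV : Differentiable ℝ V) (hV0 : ∀ x, 0 ≤ V x)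
    (he : ∀ z, e z = (fderiv ℝ u z (1, 0)) ^ 2 + (fderiv ℝ u z (0, 1)) ^ 2 + V z.2 * u z ^ 2)
    {E₀ : ℝ} (hE₀ : 0 ≤ E₀) (hE : ∀ τ, ∫⁻ y, ENNReal.ofReal (e (τ, y)) ≤ ENNReal.ofReal E₀)
    {τ a y : ℝ} (ha : u (τ, a) = 0) (hy : y ≤ a) : u (τ, y) ^ 2 ≤ 2 * (a - y) * E₀ := by
  have hf2 : ContDiff ℝ 2 (fun z : ℝ => u (τ, z)) := hu.comp (contDiff_const.prodMk contDiff_id)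
  have hf : ContDiff ℝ 1 (fun z : ℝ => u (τ, z)) := hf2.of_le (by norm_num)
  have hec := WaveEnergy.continuous_energyDensity hu hV he
  have he0 := WaveEnergy.energyDensity_nonneg hV0 he
  have hderiv : ∀ z, deriv (fun z : ℝ => u (τ, z)) z = fderiv ℝ u (τ, z) (0, 1) := fun z =>
    (WaveEnergy.hasDerivAt_slice_snd (WaveEnergy.differentiable_of_contDiff_two hu) τ z).deriv
  have hdc : Continuous fun z : ℝ => deriv (fun z : ℝ => u (τ, z)) z := by
    rw [show (fun z : ℝ => deriv (fun z : ℝ => u (τ, z)) z) = fun z => fderiv ℝ u (τ, z) (0, 1) from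
      funext hderiv]
    exact (WaveEnergy.continuous_fderiv_apply hu (0, 1)).comp (Continuous.prodMk_right τ)
  have htail : ∀ x, x ≤ a → ∫ z in x..a, deriv (fun z : ℝ => u (τ, z)) z ^ 2 ≤ E₀ := by
    intro x hx
    have h1 : ∫ z in x..a, deriv (fun z : ℝ => u (τ, z)) z ^ 2 ≤ ∫ z in x..a, e (τ, z) := by
      refine intervalIntegral.integral_mono_on hx ((hdc.pow 2).intervalIntegrable _ _)
        ((hec.comp (Continuous.prodMk_right τ)).intervalIntegrable _ _) fun z _ => ?_
      rw [hderiv, he]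
      nlinarith [sq_nonneg (fderiv ℝ u (τ, z) (1, 0)), mul_nonneg (hV0 z) (sq_nonneg (u (τ, z)))]
    have h2 : ENNReal.ofReal (∫ z in x..a, e (τ, z)) ≤ ENNReal.ofReal E₀ := by
      rw [← WaveEnergy.lintegral_Ioc_eq_ofReal_intervalIntegral (f := fun z => e (τ, z))
        (hec.comp (Continuous.prodMk_right τ)) (fun z => he0 (τ, z)) hx]
      exact (setLIntegral_le_lintegral _ _).trans (hE τ)
    exact h1.trans ((ENNReal.ofReal_le_ofReal_iff hE₀).1 h2)
  have h := RW.sq_le_of_deriv_tail_left hf htail hy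
  rw [ha] at h
  linarith

/-- **The incoming edge flux is exponentially small.** With `V ≤ K e^{−x/2}` (`K ≥ 1`), `u` and its partials
vanishing on `{S + |τ| ≤ y}` (`S ≥ 1`), slice energies `≤ E₀` and `H ≥ 0`, for `t ≥ S + H`:
`[w² + Vu²](t, −H + t) ≤ 4K²(S+H+1)³E₀ e^{(H−t)/2}`.  Transport from the foot `τ₀ = t − (S+H)/2` of the incoming
characteristic through `(t, t − H)` (where `w = 0`): along it `V ≤ K e^{(H−t)/2}` and `u² ≤ 2(S+H)E₀`.
[folklore] -/
theorem edge_flux_le (hu : ContDiff ℝ 2 u) (hV : Differentiable ℝ V) (hV0 : ∀ x, 0 ≤ V x)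
    (hsol : ∀ z : ℝ × ℝ, fderiv ℝ (fderiv ℝ u) z (1, 0) (1, 0)
      - fderiv ℝ (fderiv ℝ u) z (0, 1) (0, 1) + V z.2 * u z = 0)
    (he : ∀ z, e z = (fderiv ℝ u z (1, 0)) ^ 2 + (fderiv ℝ u z (0, 1)) ^ 2 + V z.2 * u z ^ 2)
    (hw : ∀ z, w z = fderiv ℝ u z (1, 0) + fderiv ℝ u z (0, 1))
    {K : ℝ} (hK : 1 ≤ K) (hVK : ∀ x, V x ≤ K * Real.exp (-x / 2)) {S : ℝ} (hS : 1 ≤ S)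
    (hvan : ∀ τ y, S + |τ| ≤ y → ∀ v : ℝ × ℝ, u (τ, y) = 0 ∧ fderiv ℝ u (τ, y) v = 0)
    {E₀ : ℝ} (hE₀ : 0 ≤ E₀) (hE : ∀ τ, ∫⁻ y, ENNReal.ofReal (e (τ, y)) ≤ ENNReal.ofReal E₀)
    {H t : ℝ} (hH : 0 ≤ H) (ht : S + H ≤ t) :
    w (t, -H + t) ^ 2 + V (-H + t) * u (t, -H + t) ^ 2
      ≤ 4 * K ^ 2 * (S + H + 1) ^ 3 * E₀ * Real.exp ((H - t) / 2) := by
  -- the characteristic `τ ↦ (τ, c − τ)` through `(t, −H + t)` and its foot `τ₀`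
  have hε0 : 0 < Real.exp ((H - t) / 2) := Real.exp_pos _
  have hε1 : Real.exp ((H - t) / 2) ≤ 1 := Real.exp_le_one_iff.2 (by linarith)
  have hct : t + (-H + t) - t = -H + t := by ring
  have hτ₀0 : 0 ≤ t - (S + H) / 2 := by linarith
  -- bounds along the characteristic, `τ ∈ [τ₀, t]`
  have husq : ∀ τ ∈ Icc (t - (S + H) / 2) t, u (τ, t + (-H + t) - τ) ^ 2 ≤ 2 * (S + H) * E₀ := by
    intro τ hτ
    have hτ0 : 0 ≤ τ := hτ₀0.trans hτ.1
    have ha : u (τ, S + τ) = 0 := (hvan τ (S + τ) (by rw [abs_of_nonneg hτ0]) (1, 0)).1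
    have h := sq_le_of_vanish hu hV hV0 he hE₀ hE ha (y := t + (-H + t) - τ) (by linarith [hτ.1])
    have h2 : 2 * (S + τ - (t + (-H + t) - τ)) * E₀ ≤ 2 * (S + H) * E₀ :=
      mul_le_mul_of_nonneg_right (by linarith [hτ.2]) hE₀
    exact h.trans h2
  have hVε : ∀ τ ∈ Icc (t - (S + H) / 2) t, V (t + (-H + t) - τ) ≤ K * Real.exp ((H - t) / 2) := by
    intro τ hτ
    refine (hVK _).trans (mul_le_mul_of_nonneg_left (Real.exp_le_exp.2 ?_) (by linarith))
    linarith [hτ.2]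
  have hM2 : Real.sqrt (2 * (S + H) * E₀) ^ 2 = 2 * (S + H) * E₀ := Real.sq_sqrt (by positivity)
  have hQ : ∀ τ ∈ Icc (t - (S + H) / 2) t, |V (t + (-H + t) - τ) * u (τ, t + (-H + t) - τ)|
      ≤ K * Real.exp ((H - t) / 2) * Real.sqrt (2 * (S + H) * E₀) := by
    intro τ hτ
    rw [abs_mul, abs_of_nonneg (hV0 _)]
    exact mul_le_mul (hVε τ hτ) (Real.abs_le_sqrt (husq τ hτ)) (abs_nonneg _)
      (mul_nonneg (by linarith) hε0.le)
  -- `w` vanishes at the foot and is transported to the edge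
  have h0 : w (t - (S + H) / 2, t + (-H + t) - (t - (S + H) / 2)) = 0 := by
    have h := hvan (t - (S + H) / 2) (t + (-H + t) - (t - (S + H) / 2))
      (by rw [abs_of_nonneg hτ₀0]; linarith)
    rw [hw, (h (1, 0)).2, (h (0, 1)).2, add_zero]
  have hwabs := incoming_abs_le hu hV hsol hw (c := t + (-H + t)) (by linarith : t - (S + H) / 2 ≤ t) h0 hQ
  rw [hct] at hwabs
  have hi : w (t, -H + t) ^ 2 ≤ K ^ 2 * Real.exp ((H - t) / 2) ^ 2 * (S + H) ^ 3 * E₀ / 2 := by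
    calc w (t, -H + t) ^ 2 = |w (t, -H + t)| ^ 2 := (sq_abs _).symm
      _ ≤ (K * Real.exp ((H - t) / 2) * Real.sqrt (2 * (S + H) * E₀) * (t - (t - (S + H) / 2))) ^ 2 :=
          pow_le_pow_left₀ (abs_nonneg _) hwabs 2
      _ = K ^ 2 * Real.exp ((H - t) / 2) ^ 2 * Real.sqrt (2 * (S + H) * E₀) ^ 2 * ((S + H) / 2) ^ 2 := by
          ring
      _ = K ^ 2 * Real.exp ((H - t) / 2) ^ 2 * (S + H) ^ 3 * E₀ / 2 := by rw [hM2]; ring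
  have hii : V (-H + t) * u (t, -H + t) ^ 2 ≤ K * Real.exp ((H - t) / 2) * (2 * (S + H) * E₀) := by
    have h1 := hVε t ⟨by linarith, le_rfl⟩
    have h2 := husq t ⟨by linarith, le_rfl⟩
    rw [hct] at h1 h2
    exact mul_le_mul h1 h2 (sq_nonneg _) (mul_nonneg (by linarith) hε0.le)
  -- bookkeeping: `K ≥ 1`, `S + H ≥ 1`, `e^{(H−t)/2} ≤ 1`
  have hK0 : 0 ≤ K := by linarith
  have hL1 : 1 ≤ S + H := by linarith
  have hKEε : 0 ≤ K * E₀ * Real.exp ((H - t) / 2) := by positivity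
  have p1 : 0 ≤ K * E₀ * Real.exp ((H - t) / 2) * (K * (3 * (S + H) ^ 2 + 1)) :=
    mul_nonneg hKEε (by positivity)
  have p2 : 0 ≤ K * E₀ * Real.exp ((H - t) / 2) * (K * (S + H) ^ 3) :=
    mul_nonneg hKEε (by positivity)
  have p3 : 0 ≤ K * E₀ * Real.exp ((H - t) / 2) * (K * (S + H) ^ 3 * (1 - Real.exp ((H - t) / 2))) :=
    mul_nonneg hKEε (mul_nonneg (by positivity) (by linarith))
  have p4 : 0 ≤ K * E₀ * Real.exp ((H - t) / 2) * ((S + H) * (6 * K - 1)) :=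
    mul_nonneg hKEε (mul_nonneg (by linarith) (by linarith))
  linarith [hi, hii, p1, p2, p3, p4]

/-- The far energy beyond `p` at time `t` as a real interval integral, when the energy density vanishes
beyond `B ≥ p`. [folklore] -/
theorem lintegral_Ioi_eq (hec : Continuous e) (he0 : ∀ z, 0 ≤ e z) {t p B : ℝ} (hpB : p ≤ B)
    (hzero : ∀ x, B ≤ x → e (t, x) = 0) :
    ∫⁻ x in Ioi p, ENNReal.ofReal (e (t, x)) = ENNReal.ofReal (∫ x in p..B, e (t, x)) := by
  rw [← Ioc_union_Ioi_eq_Ioi hpB, lintegral_union measurableSet_Ioi Ioc_disjoint_Ioi_same,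
    WaveEnergy.lintegral_Ioc_eq_ofReal_intervalIntegral (f := fun x => e (t, x))
      (hec.comp (Continuous.prodMk_right t)) (fun x => he0 (t, x)) hpB,
    setLIntegral_congr_fun measurableSet_Ioi
      (fun x hx => by rw [hzero x (le_of_lt hx), ENNReal.ofReal_zero]),
    lintegral_zero, add_zero]

/-- **Flux identity for the lagged far energy.** For `0 ≤ T ≤ T₂` and the energy density vanishing with the
solution beyond `S + |t|`:
`∫_{−H+T}^{S+T₂} e(T,·) = ∫_{−H+T₂}^{S+T₂} e(T₂,·) + ∫_T^{T₂} [w² + Vu²](t, −H + t) dt`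
(`WaveEnergy.energy_identity_affine`, left end moving with the edge, fixed right end beyond the support; on the
incoming null edge `m + e = (u_t + u_x)² + Vu²`). [folklore] -/
theorem farReal_eq_add_flux (hu : ContDiff ℝ 2 u) (hV : Differentiable ℝ V)
    (hsol : ∀ z : ℝ × ℝ, fderiv ℝ (fderiv ℝ u) z (1, 0) (1, 0)
      - fderiv ℝ (fderiv ℝ u) z (0, 1) (0, 1) + V z.2 * u z = 0)
    (he : ∀ z, e z = (fderiv ℝ u z (1, 0)) ^ 2 + (fderiv ℝ u z (0, 1)) ^ 2 + V z.2 * u z ^ 2)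
    (hw : ∀ z, w z = fderiv ℝ u z (1, 0) + fderiv ℝ u z (0, 1)) {S : ℝ}
    (hvan : ∀ τ y, S + |τ| ≤ y → ∀ v : ℝ × ℝ, u (τ, y) = 0 ∧ fderiv ℝ u (τ, y) v = 0)
    {H T T₂ : ℝ} (hT : 0 ≤ T) (hTT₂ : T ≤ T₂) :
    (∫ x in (-H + T)..(S + T₂), e (T, x)) = (∫ x in (-H + T₂)..(S + T₂), e (T₂, x))
      + ∫ t in T..T₂, (w (t, -H + t) ^ 2 + V (-H + t) * u (t, -H + t) ^ 2) := by
  obtain ⟨m, hm⟩ : ∃ m : ℝ × ℝ → ℝ, ∀ z, m z = 2 * fderiv ℝ u z (1, 0) * fderiv ℝ u z (0, 1) :=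
    ⟨_, fun _ => rfl⟩
  have key := WaveEnergy.energy_identity_affine hu hV hsol he hm (-H) 1 (S + T₂) 0 T T₂
  simp only [one_mul, zero_mul, add_zero] at key
  have hcongr : ∫ t in T..T₂, (m (t, S + T₂) - (m (t, -H + t) + e (t, -H + t)))
      = ∫ t in T..T₂, -(w (t, -H + t) ^ 2 + V (-H + t) * u (t, -H + t) ^ 2) := by
    refine intervalIntegral.integral_congr fun t ht => ?_
    rw [uIcc_of_le hTT₂] at ht
    have hmz : m (t, S + T₂) = 0 := by
      rw [hm, (hvan t (S + T₂) (by rw [abs_of_nonneg (hT.trans ht.1)]; linarith [ht.2]) (1, 0)).2]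
      ring
    simp only [hmz, hm, he, hw]
    ring
  rw [hcongr, intervalIntegral.integral_neg] at key
  linarith

/-- **The late drop of the lagged far energy, real form in `[0, ∞]`.** Under the hypotheses of
`edge_flux_le`, for `S + H ≤ T ≤ T₂`:
`∫⁻_{x > −H+T} e(T,·) ≤ ∫⁻_{x > −H+T₂} e(T₂,·) + ofReal (8K²(S+H+1)³e^{(H−T)/2}) · ofReal E₀`
(`farReal_eq_add_flux`, `edge_flux_le` and `∫_T^{T₂} e^{(H−t)/2} dt ≤ 2e^{(H−T)/2}`). [folklore] -/
theorem farReal_le (hu : ContDiff ℝ 2 u) (hV : Differentiable ℝ V) (hV0 : ∀ x, 0 ≤ V x)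
    (hsol : ∀ z : ℝ × ℝ, fderiv ℝ (fderiv ℝ u) z (1, 0) (1, 0)
      - fderiv ℝ (fderiv ℝ u) z (0, 1) (0, 1) + V z.2 * u z = 0)
    (he : ∀ z, e z = (fderiv ℝ u z (1, 0)) ^ 2 + (fderiv ℝ u z (0, 1)) ^ 2 + V z.2 * u z ^ 2)
    (hw : ∀ z, w z = fderiv ℝ u z (1, 0) + fderiv ℝ u z (0, 1))
    {K : ℝ} (hK : 1 ≤ K) (hVK : ∀ x, V x ≤ K * Real.exp (-x / 2)) {S : ℝ} (hS : 1 ≤ S)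
    (hvan : ∀ τ y, S + |τ| ≤ y → ∀ v : ℝ × ℝ, u (τ, y) = 0 ∧ fderiv ℝ u (τ, y) v = 0)
    {E₀ : ℝ} (hE₀ : 0 ≤ E₀) (hE : ∀ τ, ∫⁻ y, ENNReal.ofReal (e (τ, y)) ≤ ENNReal.ofReal E₀)
    {H T T₂ : ℝ} (hH : 0 ≤ H) (hT : S + H ≤ T) (hTT₂ : T ≤ T₂) :
    ∫⁻ x in Ioi (-H + T), ENNReal.ofReal (e (T, x))
      ≤ (∫⁻ x in Ioi (-H + T₂), ENNReal.ofReal (e (T₂, x)))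
        + ENNReal.ofReal (8 * K ^ 2 * (S + H + 1) ^ 3 * Real.exp ((H - T) / 2)) * ENNReal.ofReal E₀ := by
  have hec := WaveEnergy.continuous_energyDensity hu hV he
  have he0 := WaveEnergy.energyDensity_nonneg hV0 he
  have hT0 : 0 ≤ T := by linarith
  have hez : ∀ t x, S + |t| ≤ x → e (t, x) = 0 := fun t x hx => by
    rw [he, (hvan t x hx (1, 0)).1, (hvan t x hx (1, 0)).2, (hvan t x hx (0, 1)).2]
    ring
  rw [lintegral_Ioi_eq hec he0 (t := T) (B := S + T₂) (by linarith)
      (fun x hx => hez T x (by rw [abs_of_nonneg hT0]; linarith)),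
    lintegral_Ioi_eq hec he0 (t := T₂) (B := S + T₂) (by linarith)
      (fun x hx => hez T₂ x (by rw [abs_of_nonneg (hT0.trans hTT₂)]; linarith)),
    farReal_eq_add_flux hu hV hsol he hw hvan hT0 hTT₂]
  -- the integrated edge bound
  have hwc : Continuous w := by
    rw [show w = fun z => fderiv ℝ u z (1, 0) + fderiv ℝ u z (0, 1) from funext hw]
    exact (WaveEnergy.continuous_fderiv_apply hu (1, 0)).add (WaveEnergy.continuous_fderiv_apply hu (0, 1))
  have hVc := hV.continuous
  have huc := (WaveEnergy.differentiable_of_contDiff_two hu).continuous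
  have hΦc : Continuous fun t : ℝ => w (t, -H + t) ^ 2 + V (-H + t) * u (t, -H + t) ^ 2 := by fun_prop
  have hF : ∀ s, HasDerivAt (fun s : ℝ => -2 * Real.exp ((H - s) / 2)) (Real.exp ((H - s) / 2)) s := by
    intro s
    have h := ((((hasDerivAt_id' s).const_sub H).div_const 2).exp).const_mul (-2)
    refine h.congr_deriv ?_
    ring
  have hexp : ∫ s in T..T₂, Real.exp ((H - s) / 2)
      = -2 * Real.exp ((H - T₂) / 2) - -2 * Real.exp ((H - T) / 2) :=
    intervalIntegral.integral_eq_sub_of_hasDerivAt (fun s _ => hF s)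
      ((Real.continuous_exp.comp (by fun_prop)).intervalIntegrable _ _)
  have hint : ∫ t in T..T₂, (w (t, -H + t) ^ 2 + V (-H + t) * u (t, -H + t) ^ 2)
      ≤ 8 * K ^ 2 * (S + H + 1) ^ 3 * Real.exp ((H - T) / 2) * E₀ := by
    calc ∫ t in T..T₂, (w (t, -H + t) ^ 2 + V (-H + t) * u (t, -H + t) ^ 2)
        ≤ ∫ t in T..T₂, 4 * K ^ 2 * (S + H + 1) ^ 3 * E₀ * Real.exp ((H - t) / 2) :=
          intervalIntegral.integral_mono_on hTT₂ (hΦc.intervalIntegrable _ _)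
            ((continuous_const.mul (Real.continuous_exp.comp (by fun_prop))).intervalIntegrable _ _)
            fun t ht => edge_flux_le hu hV hV0 hsol he hw hK hVK hS hvan hE₀ hE hH (hT.trans ht.1)
      _ = 4 * K ^ 2 * (S + H + 1) ^ 3 * E₀ * (2 * Real.exp ((H - T) / 2) - 2 * Real.exp ((H - T₂) / 2)) := by
          rw [intervalIntegral.integral_const_mul, hexp]
          ring
      _ ≤ 4 * K ^ 2 * (S + H + 1) ^ 3 * E₀ * (2 * Real.exp ((H - T) / 2)) := by
          have h1 : 0 ≤ 4 * K ^ 2 * (S + H + 1) ^ 3 * E₀ := by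
            have : 0 ≤ S + H + 1 := by linarith
            positivity
          exact mul_le_mul_of_nonneg_left (by linarith [Real.exp_pos ((H - T₂) / 2)]) h1
      _ = 8 * K ^ 2 * (S + H + 1) ^ 3 * Real.exp ((H - T) / 2) * E₀ := by ring
  have hC0 : 0 ≤ 8 * K ^ 2 * (S + H + 1) ^ 3 * Real.exp ((H - T) / 2) := by
    have : 0 ≤ S + H + 1 := by linarith
    positivity
  have hI0 : 0 ≤ ∫ x in (-H + T₂)..(S + T₂), e (T₂, x) :=
    intervalIntegral.integral_nonneg (by linarith) fun x _ => he0 (T₂, x)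
  calc ENNReal.ofReal ((∫ x in (-H + T₂)..(S + T₂), e (T₂, x))
        + ∫ t in T..T₂, (w (t, -H + t) ^ 2 + V (-H + t) * u (t, -H + t) ^ 2))
      ≤ ENNReal.ofReal ((∫ x in (-H + T₂)..(S + T₂), e (T₂, x))
        + 8 * K ^ 2 * (S + H + 1) ^ 3 * Real.exp ((H - T) / 2) * E₀) :=
        ENNReal.ofReal_le_ofReal (by linarith)
    _ = ENNReal.ofReal (∫ x in (-H + T₂)..(S + T₂), e (T₂, x))
        + ENNReal.ofReal (8 * K ^ 2 * (S + H + 1) ^ 3 * Real.exp ((H - T) / 2)) * ENNReal.ofReal E₀ := by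
        rw [ENNReal.ofReal_add hI0 (mul_nonneg hC0 hE₀), ENNReal.ofReal_mul hC0]

end Frechet

end LateDropExp

/-- **Registered stub `stub_lateDropExp`** (crux stmt-FinalStateConjecture-14085, line `Sketch`; late drop under an
exponentially small tail — the reflected horizon side).  Let `V ≥ 0` be differentiable with `V(x) ≤ K·e^{−x/2}`
everywhere (`K ≥ 1`), and let `ψ` be a global `C²` solution with Cauchy data supported in `[−R, R]` (`R ≥ 1`).
For `H ≥ 0` and `T ≥ R + 2H + 2`:
`farEnergy V (−H) ψ T ≤ farChannelEnergy V (−H) ψ atTop + 8K²(R+H+2)³e^{(H−T)/2}·E`.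
Proof: `LateDropExp.farReal_le` (with `S = R + 1`, through the dictionary `RW.energyDensity_he`,
`RW.IsSolution.fderiv_eq`, `WaveEnergy.eq_zero_right_of_data`, `RW.totalEnergy_eq`) bounds `farEnergy(T)` by
`farEnergy(T₂) +` the constant for every `T₂ ≥ T`; pass to the `liminf` in `T₂`. [folklore] -/
theorem stub_lateDropExp : ∀ (V : ℝ → ℝ) (K : ℝ), Differentiable ℝ V → (∀ x, 0 ≤ V x) → 1 ≤ K →
    (∀ x, V x ≤ K * Real.exp (-x / 2)) →
    ∀ R H T : ℝ, 1 ≤ R → 0 ≤ H → R + 2 * H + 2 ≤ T → ∀ ψ : ℝ → ℝ → ℝ, IsSolution V ψ →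
      CauchyDataSupportedOn ψ (Icc (-R) R) →
        farEnergy V (-H) ψ T ≤ farChannelEnergy V (-H) ψ atTop
          + ENNReal.ofReal (8 * K ^ 2 * (R + H + 2) ^ 3 * Real.exp ((H - T) / 2)) * totalEnergy V ψ 0 := by
  intro V K hVd hV0 hK hVK R H T hR hH hT ψ hψ hsupp
  have hu := hψ.1
  have he := RW.energyDensity_he (V := V) hψ.1
  have hsol := RW.IsSolution.fderiv_eq hψ
  obtain ⟨w, hw⟩ : ∃ w : ℝ × ℝ → ℝ, ∀ z, w z = fderiv ℝ (Function.uncurry ψ) z (1, 0)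
      + fderiv ℝ (Function.uncurry ψ) z (0, 1) := ⟨_, fun _ => rfl⟩
  -- support: `ψ` and its first partials vanish on `{R + 1 + |τ| ≤ y}`
  have hout : ∀ y, R + 1 ≤ y → y ∉ Icc (-R) R := fun y hy h => by linarith [h.2]
  have hvan : ∀ τ y, R + 1 + |τ| ≤ y → ∀ v : ℝ × ℝ, Function.uncurry ψ (τ, y) = 0
      ∧ fderiv ℝ (Function.uncurry ψ) (τ, y) v = 0 := fun τ y hy v =>
    WaveEnergy.eq_zero_right_of_data hu hVd hV0 hsol (c := R + 1)
      (fun y hy => (hsupp y (hout y hy)).1)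
      (fun y hy => by rw [← WaveEnergy.deriv_slice_fst_eq hu]; exact (hsupp y (hout y hy)).2) hy v
  -- energy: conserved, finite, `= ofReal E₀`
  have hsupp' : CauchyDataSupportedOn ψ (Ioo (-(R + 1)) (R + 1)) := fun x hx =>
    hsupp x fun h => hx ⟨by linarith [h.1], by linarith [h.2]⟩
  have hE : ∀ τ, totalEnergy V ψ τ = ENNReal.ofReal (∫ x in (-(R + 1))..(R + 1), energyDensity V ψ 0 x) :=
    fun τ => RW.totalEnergy_eq hVd hV0 hψ (by linarith) hsupp' τ
  have hE₀ : 0 ≤ ∫ x in (-(R + 1))..(R + 1), energyDensity V ψ 0 x :=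
    intervalIntegral.integral_nonneg (by linarith) fun x _ => energyDensity_nonneg ψ 0 (hV0 x)
  -- the drop bound at every later time `T₂`
  have hT0 : 0 ≤ T := by linarith
  have hset : ∀ t : ℝ, 0 ≤ t → {x : ℝ | -H + |t| < x} = Ioi (-H + t) := fun t ht => by
    ext x
    rw [abs_of_nonneg ht, mem_setOf_eq, mem_Ioi]
  have main : ∀ T₂, T ≤ T₂ → farEnergy V (-H) ψ T ≤ farEnergy V (-H) ψ T₂
      + ENNReal.ofReal (8 * K ^ 2 * (R + H + 2) ^ 3 * Real.exp ((H - T) / 2)) * totalEnergy V ψ 0 := by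
    intro T₂ hT₂
    unfold farEnergy
    rw [hset T hT0, hset T₂ (hT0.trans hT₂), hE 0,
      show R + H + 2 = R + 1 + H + 1 by ring]
    exact LateDropExp.farReal_le hu hVd hV0 hsol he hw hK hVK (S := R + 1) (by linarith) hvan hE₀
      (fun τ => (hE τ).le) hH (by linarith) hT₂
  -- pass to the `liminf`
  have hev : ∀ᶠ T₂ in atTop, farEnergy V (-H) ψ T ≤ farEnergy V (-H) ψ T₂
      + ENNReal.ofReal (8 * K ^ 2 * (R + H + 2) ^ 3 * Real.exp ((H - T) / 2)) * totalEnergy V ψ 0 :=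
    (eventually_ge_atTop T).mono main
  unfold farChannelEnergy
  rcases eq_or_ne (ENNReal.ofReal (8 * K ^ 2 * (R + H + 2) ^ 3 * Real.exp ((H - T) / 2))
    * totalEnergy V ψ 0) ⊤ with htop | htop
  · rw [htop, add_top]
    exact le_top
  have h1 : farEnergy V (-H) ψ T
      - ENNReal.ofReal (8 * K ^ 2 * (R + H + 2) ^ 3 * Real.exp ((H - T) / 2)) * totalEnergy V ψ 0
      ≤ liminf (farEnergy V (-H) ψ) atTop :=
    le_liminf_of_le (by isBoundedDefault) (hev.mono fun t ht => tsub_le_iff_right.2 ht)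
  calc farEnergy V (-H) ψ T ≤ farEnergy V (-H) ψ T
        - ENNReal.ofReal (8 * K ^ 2 * (R + H + 2) ^ 3 * Real.exp ((H - T) / 2)) * totalEnergy V ψ 0
        + ENNReal.ofReal (8 * K ^ 2 * (R + H + 2) ^ 3 * Real.exp ((H - T) / 2)) * totalEnergy V ψ 0 :=
        le_tsub_add
    _ ≤ _ := by gcongr

end Summit.FinalStateConjecture.FinalStateConjecture.Theorems.WindowedShellChannelsSketch

end
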